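import Mathlib.NumberTheory.Transcendental.Liouville.LiouvilleWith
import Literature.NumberTheory.Irrationality.RhinViola2001.ZetaThreeMeasure
import Literature.NumberTheory.Irrationality.Zudilin2014.ZetaTwoMeasure
import Summits.KontsevichZagierPeriods.Zeta5Search.EffectiveMeasure
import Summits.KontsevichZagierPeriods.Zeta5Search.CertificateMeasure
import Summits.KontsevichZagierPeriods.Zeta5Search.RecurrenceCertificateRates
import Summits.KontsevichZagierPeriods.Zeta5Search.RecurrenceCertificateNeg
import Summits.KontsevichZagierPeriods.Zeta5Search.CalibrationAperyRates
import HarnessLib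

/-!
# ζ(5) search — criterion C4 PER CONSTANT: exponent bounds vs the records in print
# (cell `pub-zeta5`, PROVER 3; instances for the measure lane `fam-measure`, target T3)

HONEST FRAMING: systematic search; no irrationality claim unless certified.

Target **T3** of the cell is a NEW IRRATIONALITY MEASURE — a certified bound
`μ(ξ) ≤ κ` below the printed record for some classical constant `ξ`. The tree types records as
"`¬ LiouvilleWith p ξ` for every `p ≥ record`" (`Literature.…RhinViola2001.zetaThree_irrationalityExponent_lt`:
`μ(ζ(3)) < 5.513891`; `Literature.…Zudilin2014.zetaTwo_irrationalityExponent_le`: `μ(ζ(2)) ≤ 5.09541178…`)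
and the typer's C4 files produce "`¬ LiouvilleWith p ξ` for every `p > κ`" from a certificate
(`EffectiveMeasure.lean`, `CertificateMeasure.lean`, `RecurrenceCertificateRates.lean`). This file is
the thin uniform layer between the two, so that a designer's certificate plus ONE numerical
inequality `κ < record` is, by name, a new record (and, as a by-product, a PROOF of the record fact
the tree currently only cites):

* `ExponentLE ξ κ` — the predicate "the irrationality exponent of `ξ` is at most `κ`":
  `∀ p > κ, ¬ LiouvilleWith p ξ`; `ExponentLE.mono`, `ExponentLE.forall_le_of_lt` (the `≥`-rendering
  used by the Literature records), `ExponentLE.of_measure` (from `C/|b|^κ < |ξ - a/b|`),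
  `ExponentLE.of_eventual_rates` (C4: `κ = Q/σ + 1`).
* From each certificate FORMAT: `RecurrenceCertificate.exponentLE` (box exponent),
  `RecurrenceCertificate.LimitData.exponentLE_sharp` (Poincaré-sharp exponent
  `1 + (log λ∞ + δ₀)/(log λ∞ - log b - δ₀)`), `RecurrenceCertificateNeg.exponentLE`,
  `ApproximationCertificate.exponentLE`, `LinearFormCertificate.exponentLE`.
* Calibration (PROVED in the tree): `exponentLE_zetaThree_apery` — `μ(ζ(3)) ≤ 13.417…` (Apéry), via
  `CalibrationAperyRecurrence.not_liouvilleWith_zetaThree`.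
* PER CONSTANT, "beat the record": `zetaThree_record_of_exponentLE` (`κ < 5.513891` ⇒ the
  Rhin–Viola fact AND the new bound), `zetaThree_record_of_limitData` (directly from a FORMAT A′
  certificate with Poincaré data), `zetaTwo_record_of_exponentLE` (`κ < 5.09541179` ⇒ the Zudilin 2014
  fact and the new bound). For `log 2` (record `μ(log 2) < 3.57455391`, Marcovecchio, Acta Arith. 139
  (2009) Thm 1.1) and `π` (record `μ(π) ≤ 7.103205334137…`, Zeilberger–Zudilin, Moscow J. Comb. Number
  Theory 9 (2020)) the records are not yet tree facts; the generic `ExponentLE.forall_le_of_lt` is the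
  hook (`logTwo_newRecord_of_exponentLE`, `pi_newRecord_of_exponentLE` state the comparison explicitly).

Everything is PROVED (0 sorry, no named fact is introduced); no certificate is constructed here.
-/

noncomputable section

open Filter Topology
open Literature.NumberTheory.Transcendental
open Literature.NumberTheory.Irrationality

namespace Summit.KontsevichZagierPeriods.Zeta5Search

/-! ### The predicate `μ(ξ) ≤ κ` -/

/-- **`μ(ξ) ≤ κ`**: the irrationality exponent of `ξ` is at most `κ`, rendered in Mathlib's
vocabulary as "`ξ` is not `p`-Liouville for any `p > κ`" (for every `p > κ` and every `C`, only
finitely many `a/b` have `|ξ - a/b| < C/b^p`). -/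
def ExponentLE (ξ κ : ℝ) : Prop := ∀ p : ℝ, κ < p → ¬ LiouvilleWith p ξ

namespace ExponentLE

variable {ξ κ : ℝ}

/-- Monotonicity: `μ(ξ) ≤ κ ≤ κ'` gives `μ(ξ) ≤ κ'`. -/
theorem mono (h : ExponentLE ξ κ) {κ' : ℝ} (hκ : κ ≤ κ') : ExponentLE ξ κ' :=
  fun p hp => h p (lt_of_le_of_lt hκ hp)

/-- The `≥`-rendering used by the tree's record facts: `μ(ξ) ≤ κ < c` gives
`¬ LiouvilleWith p ξ` for every `p ≥ c`. -/
theorem forall_le_of_lt (h : ExponentLE ξ κ) {c : ℝ} (hc : κ < c) :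
    ∀ p : ℝ, c ≤ p → ¬ LiouvilleWith p ξ :=
  fun p hp => h p (lt_of_lt_of_le hc hp)

/-- **From an effective measure.** `C/|b|^κ < |ξ - a/b|` for all integers `a` and `b ≠ 0` (`C > 0`)
gives `μ(ξ) ≤ κ` (tree: `not_liouvilleWith_of_measure`). -/
theorem of_measure {C : ℝ} (hC : 0 < C)
    (h : ∀ a b : ℤ, b ≠ 0 → C / |(b : ℝ)| ^ κ < |ξ - a / b|) : ExponentLE ξ κ :=
  fun _ hp => not_liouvilleWith_of_measure hC h hp

/-- **C4 from eventual data** (`EffectiveMeasure.not_liouvilleWith_of_eventual_rates`): integers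
`p_r, q_r` with `|q_r| ≤ k e^{Q r}`, `|q_r ξ - p_r| ≤ l e^{-σ r}`, `p_r q_{r+1} ≠ p_{r+1} q_r` for
all large `r` (`σ, Q, k, l > 0`) give `μ(ξ) ≤ Q/σ + 1`. -/
theorem of_eventual_rates {σ Q k l : ℝ} (hσ : 0 < σ) (hQ : 0 < Q) (hk : 0 < k) (hl : 0 < l)
    {p q : ℕ → ℤ} (hq : ∀ᶠ r : ℕ in atTop, |(q r : ℝ)| ≤ k * Real.exp (Q * r))
    (happrox : ∀ᶠ r : ℕ in atTop, |(q r : ℝ) * ξ - p r| ≤ l * Real.exp (-(σ * r)))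
    (hne : ∀ᶠ r : ℕ in atTop, p r * q (r + 1) ≠ p (r + 1) * q r) :
    ExponentLE ξ (Q / σ + 1) :=
  fun _ hp => not_liouvilleWith_of_eventual_rates hσ hQ hk hl hq happrox hne hp

end ExponentLE

/-! ### From the certificate formats -/

namespace RecurrenceCertificate

variable {ξ : ℝ} (R : RecurrenceCertificate ξ)

/-- **FORMAT A′ ⇒ exponent (box form).** A recurrence certificate gives
`μ(ξ) ≤ (Q' + δ)/μ₁ + 1` with the exponents of its built approximation certificate
(`CertificateMeasure`: `RecurrenceCertificate.not_liouvilleWith`). -/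
theorem exponentLE :
    ExponentLE ξ ((R.toApproximationCertificate.growthUp + R.toApproximationCertificate.denomRate) /
      R.toApproximationCertificate.marginValue + 1) :=
  fun _ hp => R.not_liouvilleWith hp

/-- **FORMAT A′ + Poincaré ⇒ the sharp exponent.** With Poincaré data `D` (`sₙ → a`, `tₙ → b > 0`,
dominant root `λ∞`): `μ(ξ) ≤ 1 + (log λ∞ + δ₀)/(log λ∞ - log b - δ₀)`
(`RecurrenceCertificateRates`: `LimitData.not_liouvilleWith_sharp`). -/
theorem LimitData.exponentLE_sharp {R : RecurrenceCertificate ξ} (D : R.LimitData) (hb : 0 < D.b) :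
    ExponentLE ξ (1 + (Real.log D.lam + R.denomRate₀) /
      (Real.log D.lam - Real.log D.b - R.denomRate₀)) :=
  fun _ hp => D.not_liouvilleWith_sharp hb hp

end RecurrenceCertificate

/-- **FORMAT A′ with `tₙ < 0` ⇒ exponent (box form)** (`RecurrenceCertificateNeg`, the shape of
the `ζ(2)`/Catalan-type families: characteristic polynomial `x² - a x - |b|`). -/
theorem RecurrenceCertificateNeg.exponentLE {ξ : ℝ} (R : RecurrenceCertificateNeg ξ) :
    ExponentLE ξ ((R.toApproximationCertificate.growthUp + R.toApproximationCertificate.denomRate) /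
      (R.eta - 4 * R.eps) + 1) :=
  fun _ hp => (R.irrational_and_not_liouvilleWith hp).2

/-- **FORMAT A ⇒ exponent**: an approximation certificate whose Casoratian is non-zero for all
large `n` gives `μ(ξ) ≤ (Q' + δ)/μ₁ + 1` (`CertificateMeasure`:
`ApproximationCertificate.not_liouvilleWith`). -/
theorem ApproximationCertificate.exponentLE {ξ : ℝ} (cert : ApproximationCertificate ξ)
    (hW : ∀ᶠ n : ℕ in atTop, cert.u n * cert.v (n + 1) - cert.u (n + 1) * cert.v n ≠ 0) :
    ExponentLE ξ ((cert.growthUp + cert.denomRate) / cert.marginValue + 1) :=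
  fun _ hp => cert.not_liouvilleWith hW hp

/-- **FORMAT B ⇒ exponent**: a linear-form certificate with coefficient growth `|b n| ≤ k e^{Q n}`
and eventual non-proportionality gives `μ(ξ) ≤ Q/μ₁ + 1`, `μ₁ = c + φ - δ` the margin
(`CertificateMeasure`: `LinearFormCertificate.not_liouvilleWith`). -/
theorem LinearFormCertificate.exponentLE {ξ : ℝ} (cert : LinearFormCertificate ξ) {kc Q : ℝ}
    (hkc : 0 < kc) (hQ : 0 < Q)
    (hgrowth : ∀ᶠ n : ℕ in atTop, |(cert.coeffXi n : ℝ)| ≤ kc * Real.exp (Q * n))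
    (hne : ∀ᶠ n : ℕ in atTop,
      cert.coeffConst n * cert.coeffXi (n + 1) ≠ cert.coeffConst (n + 1) * cert.coeffXi n) :
    ExponentLE ξ (Q / cert.margin + 1) :=
  fun _ hp => cert.not_liouvilleWith hkc hQ hgrowth hne hp

/-! ### Calibration: Apéry's exponent for `ζ(3)` (PROVED in the tree) -/

/-- **`μ(ζ(3)) ≤ 1 + (log(17+12√2) + 3)/(log(17+12√2) - 3) = 13.417…`** (Apéry 1979), in the
`ExponentLE` vocabulary — the tree's PROVED `CalibrationAperyRecurrence.not_liouvilleWith_zetaThree`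
(FORMAT A′ + Poincaré on the Apéry recurrence). The record in print is `5.513891` (Rhin–Viola 2001). -/
theorem exponentLE_zetaThree_apery :
    ExponentLE (zetaValue 3)
      (1 + (Real.log (17 + 12 * Real.sqrt 2) + 3) / (Real.log (17 + 12 * Real.sqrt 2) - 3)) :=
  fun _ hp => CalibrationAperyRecurrence.not_liouvilleWith_zetaThree hp

/-! ### Per constant: what beats the record -/

/-- **`ζ(3)`: beating Rhin–Viola.** A certified `μ(ζ(3)) ≤ κ` with `κ < 5.513891` proves the tree's
cited record fact `RhinViola2001.zetaThree_irrationalityExponent_lt` (`μ(ζ(3)) < 5.513891`, Acta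
Arith. 97 (2001) Thm 5.1) as a COROLLARY, together with the new bound `∀ p > κ, ¬ LiouvilleWith p ζ(3)`.
(No such `κ` is certified anywhere in the tree: the cell's proved exponent is Apéry's `13.417…`.) -/
theorem zetaThree_record_of_exponentLE {κ : ℝ} (h : ExponentLE (zetaValue 3) κ)
    (hκ : κ < 5.513891) :
    RhinViola2001.zetaThree_irrationalityExponent_lt ∧
      ∀ p : ℝ, κ < p → ¬ LiouvilleWith p (zetaValue 3) :=
  ⟨h.forall_le_of_lt hκ, h⟩

/-- **`ζ(3)`: beating Rhin–Viola with a FORMAT A′ certificate.** A recurrence certificate for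
`ζ(3)` with Poincaré data (`tₙ → b > 0`, dominant root `λ∞`, `lcm`-denominator rate `δ₀`) whose sharp
exponent satisfies `1 + (log λ∞ + δ₀)/(log λ∞ - log b - δ₀) < 5.513891` proves the Rhin–Viola record
fact and the new measure. (For Apéry's recurrence the left side is `13.417…`; implication only.) -/
theorem zetaThree_record_of_limitData (R : RecurrenceCertificate (zetaValue 3)) (D : R.LimitData)
    (hb : 0 < D.b)
    (hκ : 1 + (Real.log D.lam + R.denomRate₀) / (Real.log D.lam - Real.log D.b - R.denomRate₀) <
      5.513891) :
    RhinViola2001.zetaThree_irrationalityExponent_lt ∧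
      ExponentLE (zetaValue 3)
        (1 + (Real.log D.lam + R.denomRate₀) / (Real.log D.lam - Real.log D.b - R.denomRate₀)) :=
  ⟨(D.exponentLE_sharp hb).forall_le_of_lt hκ, D.exponentLE_sharp hb⟩

/-- **`ζ(2)`: beating Zudilin 2014.** A certified `μ(ζ(2)) ≤ κ` with `κ < 5.09541179` proves the
tree's cited record fact `Zudilin2014.zetaTwo_irrationalityExponent_le` (`μ(ζ(2)) ≤ 5.09541178…`,
Zudilin 2014 Thm 1) as a corollary, together with the new bound. (`ζ(2) = π²/6`, so this is also a
measure for `π²`; implication only — nothing of the kind is certified in the tree.) -/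
theorem zetaTwo_record_of_exponentLE {κ : ℝ} (h : ExponentLE (zetaValue 2) κ)
    (hκ : κ < 5.09541179) :
    Zudilin2014.zetaTwo_irrationalityExponent_le ∧
      ∀ p : ℝ, κ < p → ¬ LiouvilleWith p (zetaValue 2) :=
  ⟨h.forall_le_of_lt hκ, h⟩

/-- **`log 2`: the comparison with the record in print.** A certified `μ(log 2) ≤ κ` with
`κ < 3.57455391` gives `¬ LiouvilleWith p (log 2)` for every `p ≥ 3.57455391` and every `p > κ` — i.e.
it would supersede the printed record `μ(log 2) < 3.57455391` (R. Marcovecchio, *The Rhin–Viola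
method for log 2*, Acta Arith. 139 (2009) 147–184, Theorem 1.1 (1); not yet a tree fact). -/
theorem logTwo_newRecord_of_exponentLE {κ : ℝ} (h : ExponentLE (Real.log 2) κ)
    (hκ : κ < 3.57455391) :
    (∀ p : ℝ, (3.57455391 : ℝ) ≤ p → ¬ LiouvilleWith p (Real.log 2)) ∧
      ∀ p : ℝ, κ < p → ¬ LiouvilleWith p (Real.log 2) :=
  ⟨h.forall_le_of_lt hκ, h⟩

/-- **`π`: the comparison with the record in print.** A certified `μ(π) ≤ κ` with
`κ < 7.103205334137` gives `¬ LiouvilleWith p π` for every `p ≥ 7.103205334137` and every `p > κ` —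
it would supersede the printed record `μ(π) ≤ 7.10320533413700172…` (D. Zeilberger, W. Zudilin,
*The irrationality measure of π is at most 7.103205334137…*, Moscow J. Comb. Number Theory 9 (2020)
407–419, final display; not yet a tree fact). -/
theorem pi_newRecord_of_exponentLE {κ : ℝ} (h : ExponentLE Real.pi κ) (hκ : κ < 7.103205334137) :
    (∀ p : ℝ, (7.103205334137 : ℝ) ≤ p → ¬ LiouvilleWith p Real.pi) ∧
      ∀ p : ℝ, κ < p → ¬ LiouvilleWith p Real.pi :=
  ⟨h.forall_le_of_lt hκ, h⟩

end Summit.KontsevichZagierPeriods.Zeta5Search
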